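import Summits.BirchSwinnertonDyer.Rank1Residual.ManinAdditive.ShimuraCoverMuThreeSplit
import Summits.BirchSwinnertonDyer.Rank1Residual.ManinAdditive.KummerDiamondShapeLaws
import HarnessLib
import HarnessLib.Audit.Tags

/-!
# STEP 1 of MEMO-es §59.5 in Lean: in the index-4 world Stevens' curve has all its 2-torsion rational (⟸ F★ [∧ CES])
(cell `bsd-f2-manin`, seat `-es` g38, MEMO-es §59.16; crux C2 `ManinOddAtFour` stmt-BirchSwinnertonDyer-22967, row E-es-185)

In the index-4 world `Λ₁(f) = 2Λ₀(f)` the kernel `u₁(c₁Λ₀(f)) ≅ Λ₀(f)/Λ₁(f)` of the Shimura cover `W₁ → W₀` is ALL of `W₁[2]`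
(`c₁Λ₀ = ½ c₁Λ₁ = ½ Λ_{W₁}` by optimality), and every kernel point is rational by the registered printed fact
F★ = `optimalGamma1Parametrization_cusp_rational` (an g41's E-an-235a `exists_rational_eq_uniformize_of_mem_periodLattice`).  Hence:
every `2`-torsion point of `W₁(ℂ)` is the base change of a point of `W₁(ℚ)` — Stevens' curve has full rational `2`-torsion.  With
CES = `exists_optimal_gamma1ParametrizationData` the same is packaged from a lattice-optimal `X₀(N)`-datum of `W₀` (the shape of the
hypotheses of E-es-185 `IndexFourForcesFreyTwistShape`).  This is STEP 1 of the paper proof of E-es-185 (§59.5; referee ref1 §R215: SOUND);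
STEPS 2–4 (Kummer–diamond reciprocity at the Atkin–Lehner cusps + Kummer signs) are NOT formalised here.  No sorry; no new facts.
[cite: Stevens1989, §2 (the Shimura cover E₁ → E₀; its kernel is constant / μ-type)] [cite: Vatsal2005, Rem. 1.8]
[cite: ConradEdixhovenStein2003, §6.1.2, §6.2 (cusps over ∞ map to rational points of the X₁(N)-optimal curve)]

TYPER NOTE (typer g21, T-es-74 (E)).  SOURCE = HOME/es/g38/IndexFourStevensTwoTorsion-es-g38.lean sha16 a2ad47f77004854d (73 l.; es: farm rc 0·0·0·0;
MEMO-es §59.16; evidence on 22967) VERBATIM (this note is the only delta).  CONE SIDE by construction (like `ShimuraCoverMuThreeSplit.lean`): it imports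
`…ManinAdditive.ShimuraCoverMuThreeSplit` (inside the `Theses.ManinLocalTwoThree` import cone) + the route-independent leaf `…KummerDiamondShapeLaws`;
theorem-only (kind proof), no statement introduced; the tree had no declaration of these names at landing (rg 03:3xZ).  PROVED: STEP 1 of es's
E-es-185 proof modulo the registered printed facts F★ (`optimalGamma1Parametrization_cusp_rational`) and CES (`exists_optimal_gamma1ParametrizationData`);
STEPS 2–4 not formalised.  bears_on: stmt-BirchSwinnertonDyer-22967 (C2 `ManinOddAtFour`).  BSD is not proved by this; C2/C3 OPEN.
-/

set_option autoImplicit false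

noncomputable section

open scoped Classical MatrixGroups ModularForm
open CongruenceSubgroup WeierstrassCurve Literature.NumberTheory.EllipticCurves Literature.NumberTheory.EllipticCurves.ModularForms
open Summit.BirchSwinnertonDyer.BirchSwinnertonDyer.Theorems.ManinLocalTwoThree
open Summit.BirchSwinnertonDyer.BirchSwinnertonDyer.Theorems.ManinLocalTwoThree.CuspGalois
open Summit.BirchSwinnertonDyer.Rank1Residual.ManinAdditive.ShimuraCover

namespace Summit.BirchSwinnertonDyer.Rank1Residual.ManinAdditive.KummerDiamond

section StevensCurve

variable {W₁ : WeierstrassCurve ℚ} [W₁.IsElliptic] {N : ℕ} [NeZero N]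

/-- **STEP 1 on Stevens' curve (PROVED ⟸ F★).**  For an OPTIMAL `X₁(N)`-datum `D₁` of `W₁` in the index-4 world
`Λ₁(f) = 2Λ₀(f)`, every `2`-torsion point of `W₁(ℂ)` is rational. [cite: Stevens1989, §2] [cite: Vatsal2005, Rem. 1.8] -/
theorem stevens_twoTorsion_rational_of_indexFour (hF : optimalGamma1Parametrization_cusp_rational)
    (D₁ : Gamma1ParametrizationData W₁ N) (hD₁ : D₁.IsOptimal)
    (hidx : ∀ z : ℂ, z ∈ periodLatticeGamma1 D₁.f ↔ ∃ w ∈ periodLattice D₁.f, z = 2 * w)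
    (T : (W₁.baseChange ℂ).toAffine.Point) (hT : 2 • T = 0) :
    ∃ P : (W₁.baseChange ℚ).toAffine.Point, Affine.Point.baseChange (W' := W₁) ℚ ℂ P = T := by
  obtain ⟨z, rfl⟩ := D₁.uniformize_surjective T
  have h2 : D₁.uniformize (2 • z) = 0 := by rw [map_nsmul]; exact hT
  rw [gamma1_uniformize_eq_zero_iff, nsmul_eq_mul, Nat.cast_ofNat] at h2
  obtain ⟨y, hy, hyz⟩ := hD₁ _ h2
  obtain ⟨w, hw, rfl⟩ := (hidx y).mp hy
  have hz : z = (D₁.c : ℂ) * w :=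
    mul_left_cancel₀ (two_ne_zero' ℂ) (by rw [hyz]; ring)
  obtain ⟨P, hP⟩ := exists_rational_eq_uniformize_of_mem_periodLattice hF D₁ hD₁ hw
  exact ⟨P, by rw [hP, hz]⟩

end StevensCurve

/-- **STEP 1 from a lattice-optimal `X₀(N)`-datum (PROVED ⟸ F★ ∧ CES)** — the hypotheses of E-es-185: CES supplies Stevens'
curve `W₁` (isogenous to `W₀`, optimal `X₁(N)`-datum of the SAME newform by multiplicity one), and in the index-4 world all of its
`2`-torsion is rational. [cite: ConradEdixhovenStein2003, Thm. 1.1.3, §6.2] [cite: Stevens1989, §2] -/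
theorem exists_stevensCurve_twoTorsion_rational_of_indexFour (hF : optimalGamma1Parametrization_cusp_rational)
    (hex : exists_optimal_gamma1ParametrizationData)
    (W₀ : WeierstrassCurve ℚ) [W₀.IsElliptic] [W₀.IsGloballyMinimal] {N : ℕ} [NeZero N]
    (D₀ : ModularParametrizationData W₀ N) (hopt : ∀ z ∈ D₀.L.lattice, ∃ w ∈ periodLattice D₀.f, z = D₀.c * w)
    (hidx : ∀ z : ℂ, z ∈ periodLatticeGamma1 D₀.f ↔ ∃ w ∈ periodLattice D₀.f, z = 2 * w) :
    ∃ (W₁ : WeierstrassCurve ℚ) (_ : W₁.IsElliptic) (_ : W₁.IsGloballyMinimal) (D₁ : Gamma1ParametrizationData W₁ N),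
      IsIsogenous W₁ W₀ ∧ D₁.IsOptimal ∧ D₁.f = D₀.f ∧
      ∀ T : (W₁.baseChange ℂ).toAffine.Point, 2 • T = 0 →
        ∃ P : (W₁.baseChange ℚ).toAffine.Point, Affine.Point.baseChange (W' := W₁) ℚ ℂ P = T := by
  obtain ⟨W₁, _, _, D₁, hiso, hD₁⟩ := hex W₀ D₀ hopt
  have hf : D₁.f = D₀.f := D₁.isNewformOf.unique (D₀.isNewformOf.of_isIsogenous hiso)
  refine ⟨W₁, ‹_›, ‹_›, D₁, hiso, hD₁, hf, fun T hT => ?_⟩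
  exact stevens_twoTorsion_rational_of_indexFour hF D₁ hD₁ (by rw [hf]; exact hidx) T hT

end Summit.BirchSwinnertonDyer.Rank1Residual.ManinAdditive.KummerDiamond
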